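import Summits.CriticalPhenomena.PercolationContinuityZ3.Theorems.PercNearOneGluingNoHeavyLowerTailCILIsolatedObserver
import HarnessLib

/-!
# `NoHeavyLowerTail` (stmt-CriticalPhenomena-4575) — the LOSSY STAR TRANSFER: Kozma–Nitzan's Lemma 5 and
# Theorem 8 with an additive slack, for an ARBITRARY fixed witness

Support file (engine seat `prim-cplus-engine` g2; `--supports stmt-CriticalPhenomena-4575`).  No definitions,
no named facts, no sorries.

Kozma–Nitzan's Theorem 8 (tree: `Literature.Probability.Percolation.KozmaNitzan2024_thm8_event`) compares a
one-layer observer `o` (every positive-weight neighbour of `o` is a relay) with the CHAMPION `a₀` of the graph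
`G ∖ {o}` — the relay whose cluster most often fails the monotone property there; its engine is Lemma 5, which
needs the witness `a` to be at least as "fragile" in `G ∖ {o}` as some open neighbour `v` of the star pattern
`σ_B`.  The printed Lemma 3(ii) (tree: `KozmaNitzan2024_lemma3_ii_cluster`) already carries an ADDITIVE slack
`δ`, and that slack survives the whole argument.  This file records the resulting LOSSY versions, in which the
witness is an ARBITRARY vertex `a ≠ o` and the defect of fragility is paid additively:

* `LossyStar.real_union_le_of_le_cluster_add` — the gluing step on `G ∖ {0}` with slack: if
  `P(P(C(a))) ≤ P(P(C(v))) + δ` then `P(({P(C(a))} ∩ {a ↮ B}) ∪ ({a ↔ B} ∩ Z)) ≤ P(Z) + δ` for every `Z ⊇ {P(C(v))}`.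
* `LossyStar.lemma5_add` — **Lemma 5 with slack**: for `a, v ≠ 0`, `v ∈ B`, if
  `P_{G∖{0}}(P(C(a))) ≤ P_{G∖{0}}(P(C(v))) + δ` then `P(P(C(a)), σ_B) ≤ P(P(C(0)), σ_B) + δ · P(σ_B)`.
* `LossyStar.thm8_add` — **Theorem 8 with slack, any witness**: if `o ∉ A` is isolated in `G ∖ A` and for every
  nonempty `B ⊆ A` some `v ∈ B` satisfies `P_{G∖{o}}(P(C(c))) ≤ P_{G∖{o}}(P(C(v))) + Δ(B)` (`Δ ≥ 0`; for `c ∈ B`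
  take `v = c`, `Δ(B)` arbitrary), then
  `P(P(C(c)), o ↔ A) ≤ P(P(C(o)), o ↔ A) + Σ_{B ⊆ A} Δ(B) · P(σ_B)`.
* `LossyStar.lowerTail_le_add` — the crux's vocabulary (`P(S) = (j+1 ≤ |S ∩ A|)`): for a one-layer observer and
  ANY vertex `c ≠ o`,  `μ{1 ≤ N ≤ j} ≤ μ({o ↔ A} ∩ {|π(c)| ≤ j}) + Σ_{B ⊆ A} Δ(B) · μ(σ_B)`, where it suffices
  that for every nonempty `B ⊆ A` some `v ∈ B` has `Φ'(v) − Φ'(c) ≤ Δ(B)`, `Φ'(x) := μ_{G∖{o}}{|π(x)| ≤ j}`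
  (`cumulativeIsolation_preFKG_of_isolatedObserver` is the case `c = a₀`, `Δ ≡ 0`).

WHY (engine memo `run/shared/lean/prim/prim-cplus-engine/ENGINE-g2.md` §3): conditioning on the observer's
relay-free cluster `W` turns every observer into a one-layer observer `W/W` of `H_W = G[V ∖ W] + o'`; summing
`lowerTail_le_add` over the pocket states gives, for EVERY fixed relay `c`,
`P(1 ≤ N ≤ j) ≤ P(|π(c)| ≤ j) + GAP(c)`, `GAP(c) = E[(min_{v ∈ R} Φ_{G−W}(v) − Φ_{G−W}(c))⁺ ; R ≠ ∅, c ∉ R]`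
— a champion-free, designation-free reduction of the cumulative isolation lemma whose residual is an explicit
functional of the observer's pocket (numerically `min_c` of the right side is within `1.05 (t + P(o ↮ A))` in
every adversarial search so far).  The one-layer brick is this file; the pocket conditioning is future work.
-/

noncomputable section

namespace Summit.CriticalPhenomena.PercolationContinuityZ3.Theorems

open MeasureTheory Set Literature.Probability.LatticeModels Literature.Probability.Percolation
open Literature.Probability.Percolation.KNPreFKG
open scoped Classical BigOperators

namespace LossyStar

variable {V : Type*}

section Glue

variable [Fintype V]

/-- **The gluing step on `G ∖ {0}` with an additive slack** (Kozma–Nitzan Lemma 3(ii) with `Q = {a ↮ B}`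
and slack `δ`): if `P(P(C(a))) ≤ P(P(C(v))) + δ` for a monotone vertex-set property `P`, then for every set
`Z` of configurations containing `{P(C(v))}`,
`P(({P(C(a))} ∩ {a ↮ B}) ∪ ({a ↔ B} ∩ Z)) ≤ P(Z) + δ`.
[cite: KozmaNitzan2024, Lemma 3(ii) (pp. 6–7) and Lemma 5 (p. 13)] -/
theorem real_union_le_of_le_cluster_add (w : Sym2 V → unitInterval) (a v : V) (B : Set V)
    (P : Set V → Prop) (hP : ∀ S T : Set V, S ⊆ T → P S → P T) (Z : Set (BondConfig V))
    (hvZ : {ω : BondConfig V | P (openCluster ω v)} ⊆ Z) {δ : ℝ} (hδ : 0 ≤ δ)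
    (h : (prodBernoulli w).real {ω | P (openCluster ω a)} ≤
      (prodBernoulli w).real {ω | P (openCluster ω v)} + δ) :
    (prodBernoulli w).real (({ω : BondConfig V | P (openCluster ω a)} ∩
          {ω | ∀ u ∈ B, ¬ (openGraph ω).Reachable a u}) ∪
        ({ω | ∃ u ∈ B, (openGraph ω).Reachable a u} ∩ Z)) ≤
      (prodBernoulli w).real Z + δ := by
  classical
  set μ := prodBernoulli w with hμ
  set X : Set (BondConfig V) := {ω | P (openCluster ω a)} with hX
  set Y : Set (BondConfig V) := {ω | ∃ u ∈ B, (openGraph ω).Reachable a u} with hY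
  set N : Set (BondConfig V) := {ω | ∀ u ∈ B, ¬ (openGraph ω).Reachable a u} with hN
  -- Lemma 3(ii) with slack, `Q = {a ↮ B}`
  have L3 : μ.real (X ∩ N) ≤ μ.real ({ω : BondConfig V | P (openCluster ω v)} ∩ N) + δ := by
    have key := KozmaNitzan2024_lemma3_ii_cluster w a v P hP hδ h (isLowerSet_disconnFamily a B)
    rw [← setOf_forall_not_reachable_eq] at key
    exact key
  -- `{P(C(v)), a ↮ B} ⊆ Z ∩ N`
  have h2 : μ.real ({ω : BondConfig V | P (openCluster ω v)} ∩ N) ≤ μ.real (Z ∩ N) :=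
    measureReal_mono fun ω ⟨h1, hn⟩ => ⟨hvZ h1, hn⟩
  -- `Y ∩ Z ⊆ Z ∖ N`
  have hYN : Y ∩ Z ⊆ Z ∩ Nᶜ := by
    rintro ω ⟨⟨u, hu, hau⟩, hz⟩
    exact ⟨hz, fun hn => hn u hu hau⟩
  have hsplit : μ.real Z = μ.real (Z ∩ N) + μ.real (Z ∩ Nᶜ) := by
    rw [← measureReal_inter_add_sdiff (s := Z) (MeasurableSet.of_discrete : MeasurableSet N),
      Set.sdiff_eq]
  calc μ.real ((X ∩ N) ∪ (Y ∩ Z)) ≤ μ.real (X ∩ N) + μ.real (Y ∩ Z) := measureReal_union_le _ _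
    _ ≤ (μ.real (Z ∩ N) + δ) + μ.real (Z ∩ Nᶜ) :=
        add_le_add (L3.trans (by linarith [h2])) (measureReal_mono hYN)
    _ = μ.real Z + δ := by rw [hsplit]; ring

/-- **Kozma–Nitzan's Lemma 5 with an additive slack** (monotone `{0,1}`-valued cluster property).  Let
`a, v ≠ 0`, `v ∈ B`, and suppose that in `G ∖ {0}` the cluster of `a` has `P` at most `δ` more often than the
cluster of `v`: `P_{G∖{0}}(P(C(a))) ≤ P_{G∖{0}}(P(C(v))) + δ` (`δ ≥ 0`).  Then
`P(P(C(a)), σ_B) ≤ P(P(C(0)), σ_B) + δ · P(σ_B)`, `σ_B` the event that the open pairs at `0` are exactly those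
to `B`.  The proof is the tree's `KozmaNitzan2024_lemma5_cluster` verbatim with the slack carried through the
gluing step (`real_union_le_of_le_cluster_add`) and the independence of the star of `0` from the pairs off `0`.
[cite: KozmaNitzan2024, Lemma 5 (p. 13), Lemma 3 (pp. 6–7)] -/
theorem lemma5_add (w : Sym2 V → unitInterval)
    (o a v : V) (B : Set V) (P : Set V → Prop) (hP : ∀ S T : Set V, S ⊆ T → P S → P T)
    (hao : a ≠ o) (hvo : v ≠ o) (hvB : v ∈ B) {δ : ℝ} (hδ : 0 ≤ δ)
    (hyp : (prodBernoulli w).real {ω | P {y | ω ∈ openConnIn ({o}ᶜ : Set V) a y}} ≤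
      (prodBernoulli w).real {ω | P {y | ω ∈ openConnIn ({o}ᶜ : Set V) v y}} + δ) :
    (prodBernoulli w).real ({ω | P (openCluster ω a)} ∩ starEvent o B) ≤
      (prodBernoulli w).real ({ω | P (openCluster ω o)} ∩ starEvent o B) +
        δ * (prodBernoulli w).real (starEvent o B) := by
  classical
  set μ := prodBernoulli w with hμ
  -- the graph `G ∖ {0}`
  set S : Set V := {o}ᶜ with hS
  haveI : Fintype S := Fintype.ofFinite S
  set f : S → V := Subtype.val with hf
  set w' : Sym2 S → unitInterval := w ∘ Sym2.map f with hw'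
  set μ' := prodBernoulli w' with hμ'
  have haS : a ∈ S := mem_compl_singleton_iff.2 hao
  have hvS : v ∈ S := mem_compl_singleton_iff.2 hvo
  set a' : S := ⟨a, haS⟩ with ha'
  set v' : S := ⟨v, hvS⟩ with hv'
  set B' : Set S := {u | (u : V) ∈ B} with hB'
  have hvB' : v' ∈ B' := hvB
  -- the property transported to vertex sets of `G ∖ {0}` (read back in `G`)
  set P' : Set S → Prop := fun T => P (Subtype.val '' T) with hP'
  have hP'mono : ∀ T T' : Set S, T ⊆ T' → P' T → P' T' :=
    fun T T' hTT' hT => hP _ _ (image_mono hTT') hT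
  -- the hypothesis, read on `G ∖ {0}`
  have hyp' : μ'.real {ω' | P' (openCluster ω' a')} ≤ μ'.real {ω' | P' (openCluster ω' v')} + δ := by
    rw [hμ', hw', hf, ← real_preimage_restrictConfig_val, ← real_preimage_restrictConfig_val,
      preimage_setOf_prop_openCluster, preimage_setOf_prop_openCluster]
    exact hyp
  -- the events on `G ∖ {0}`
  set X : Set (BondConfig S) := {ω' | P' (openCluster ω' a')} with hX
  set N : Set (BondConfig S) := {ω' | ∀ u ∈ B', ¬ (openGraph ω').Reachable a' u} with hN
  set Y : Set (BondConfig S) := {ω' | ∃ u ∈ B', (openGraph ω').Reachable a' u} with hY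
  set Z : Set (BondConfig S) :=
    {ω' | P ({o} ∪ Subtype.val '' {y' | ∃ u ∈ B', (openGraph ω').Reachable u y'})} with hZ
  have hvZ : {ω' : BondConfig S | P' (openCluster ω' v')} ⊆ Z := by
    intro ω' hω'
    refine hP _ _ ?_ hω'
    rintro y ⟨y', hy', rfl⟩
    exact Or.inr ⟨y', ⟨v', hvB', hy'⟩, rfl⟩
  have hWZ : μ.real (restrictConfig f ⁻¹' ((X ∩ N) ∪ (Y ∩ Z))) ≤ μ.real (restrictConfig f ⁻¹' Z) + δ := by
    rw [hf, real_preimage_restrictConfig_val, real_preimage_restrictConfig_val]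
    exact real_union_le_of_le_cluster_add w' a' v' B' P' hP'mono Z hvZ hδ hyp'
  -- `{P(C(a))} ∩ σ ⊆ σ ∩ pull-back of (X ∩ N) ∪ (Y ∩ Z)`
  have hsub1 : {ω : BondConfig V | P (openCluster ω a)} ∩ starEvent o B ⊆
      starEvent o B ∩ restrictConfig f ⁻¹' ((X ∩ N) ∪ (Y ∩ Z)) := by
    rintro ω ⟨hPa, hσ⟩
    refine ⟨hσ, ?_⟩
    rw [mem_preimage]
    by_cases hn : ∀ u ∈ B, u ≠ o → ω ∉ openConnIn ({o}ᶜ : Set V) a u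
    · -- `a ↮ B` off `0`: the cluster of `a` avoids `0` and is its cluster in `G ∖ {0}`
      left
      refine ⟨?_, ?_⟩
      · change P' (openCluster (restrictConfig f ω) a')
        rw [hP']
        change P (Subtype.val '' openCluster (restrictConfig Subtype.val ω) a')
        rw [KNPreFKG.image_openCluster_restrictConfig]
        refine hP _ _ (fun x hx => ?_) hPa
        have hxo : x ≠ o := by
          rintro rfl
          obtain ⟨p⟩ := (hx : (openGraph ω).Reachable a x).symm
          obtain ⟨u', hu'B, hu'o, hu'a⟩ := (walk_decomp hσ p hao).2 rfl
          obtain ⟨h1, h2, hr⟩ := hu'a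
          exact hn u' hu'B hu'o ⟨h2, h1, hr.symm⟩
        obtain ⟨p⟩ := (hx : (openGraph ω).Reachable a x)
        rcases (walk_decomp hσ p hxo).1 hao with h | ⟨⟨u, huB, huo, hau⟩, _⟩
        · exact h
        · exact absurd hau (hn u huB huo)
      · intro u huB hau
        have huo : (u : V) ≠ o := mem_compl_singleton_iff.1 u.2
        exact hn u huB huo ((reachable_restrictConfig_val_iff S ω a' u).1 hau)
    · -- `a ↔ B` off `0`: the cluster of `a` is inside `{0} ∪ C_{G∖0}(B)`
      right
      push Not at hn
      obtain ⟨u, huB, huo, hau⟩ := hn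
      have huS : u ∈ S := mem_compl_singleton_iff.2 huo
      refine ⟨⟨⟨u, huS⟩, huB, (reachable_restrictConfig_val_iff S ω a' ⟨u, huS⟩).2 hau⟩, ?_⟩
      change P ({o} ∪ Subtype.val '' {y' | ∃ u ∈ B', (openGraph (restrictConfig f ω)).Reachable u y'})
      refine hP _ _ (fun x hx => ?_) hPa
      by_cases hxo : x = o
      · exact Or.inl hxo
      · right
        have hxS : x ∈ S := mem_compl_singleton_iff.2 hxo
        obtain ⟨p⟩ := (hx : (openGraph ω).Reachable a x)
        rcases (walk_decomp hσ p hxo).1 hao with h | ⟨_, ⟨u', hu'B, hu'o, hu'x⟩⟩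
        · -- `a ↔ x` off `0`, and `a ↔ u` off `0`
          refine ⟨⟨x, hxS⟩, ⟨⟨u, huS⟩, huB, ?_⟩, rfl⟩
          have h1 : (openGraph (restrictConfig f ω)).Reachable a' ⟨u, huS⟩ :=
            (reachable_restrictConfig_val_iff S ω a' ⟨u, huS⟩).2 hau
          have h2 : (openGraph (restrictConfig f ω)).Reachable a' ⟨x, hxS⟩ :=
            (reachable_restrictConfig_val_iff S ω a' ⟨x, hxS⟩).2 h
          exact h1.symm.trans h2
        · have hu'S : u' ∈ S := mem_compl_singleton_iff.2 hu'o
          exact ⟨⟨x, hxS⟩, ⟨⟨u', hu'S⟩, hu'B,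
            (reachable_restrictConfig_val_iff S ω ⟨u', hu'S⟩ ⟨x, hxS⟩).2 hu'x⟩, rfl⟩
  -- `σ ∩ pull-back of Z ⊆ {P(C(0))} ∩ σ`
  have hsub2 : starEvent o B ∩ restrictConfig f ⁻¹' Z ⊆
      {ω : BondConfig V | P (openCluster ω o)} ∩ starEvent o B := by
    rintro ω ⟨hσ, hz⟩
    refine ⟨?_, hσ⟩
    rw [mem_preimage] at hz
    change P ({o} ∪ Subtype.val '' {y' | ∃ u ∈ B', (openGraph (restrictConfig f ω)).Reachable u y'}) at hz
    refine hP _ _ (fun x hx => ?_) hz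
    rcases hx with hxo | ⟨y', ⟨u, huB, huy⟩, rfl⟩
    · rw [mem_singleton_iff] at hxo
      subst hxo
      exact mem_openCluster_self ω x
    · have huy' : (openGraph ω).Reachable (u : V) y' :=
        reachable_of_openConnIn ((reachable_restrictConfig_val_iff S ω u y').1 huy)
      have huo : (u : V) ≠ o := mem_compl_singleton_iff.1 u.2
      have hou : s(o, (u : V)) ∈ ω := ((mem_starEvent_iff o B ω).1 hσ u huo).2 huB
      have hadj : (openGraph ω).Adj o u := (openGraph_adj ω o u).2 ⟨hou, huo.symm⟩
      exact hadj.reachable.trans huy'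
  -- assemble with the independence of `σ` from the pairs off `0`
  have hσ0 : 0 ≤ μ.real (starEvent o B) := measureReal_nonneg
  calc μ.real ({ω | P (openCluster ω a)} ∩ starEvent o B)
      ≤ μ.real (starEvent o B ∩ restrictConfig f ⁻¹' ((X ∩ N) ∪ (Y ∩ Z))) := measureReal_mono hsub1
    _ = μ.real (starEvent o B) * μ.real (restrictConfig f ⁻¹' ((X ∩ N) ∪ (Y ∩ Z))) :=
        real_starEvent_inter_preimage w o B _
    _ ≤ μ.real (starEvent o B) * (μ.real (restrictConfig f ⁻¹' Z) + δ) :=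
        mul_le_mul_of_nonneg_left hWZ hσ0
    _ = μ.real (starEvent o B ∩ restrictConfig f ⁻¹' Z) + δ * μ.real (starEvent o B) := by
        rw [real_starEvent_inter_preimage w o B Z]; ring
    _ ≤ μ.real ({ω | P (openCluster ω o)} ∩ starEvent o B) + δ * μ.real (starEvent o B) := by
        have := measureReal_mono (μ := μ) hsub2
        linarith

/-- **Kozma–Nitzan's Theorem 8 with an additive slack, for an ARBITRARY witness.**  Let `o ∉ A` be isolated in
`G ∖ A` (every pair `s(o,u)` with `u ∉ A`, `u ≠ o` has weight `0`), `P` a monotone vertex-set property, `c ≠ o`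
any vertex, and `Δ : Finset V → ℝ` nonnegative such that for every nonempty `B ⊆ A` some `v ∈ B` satisfies
`P_{G∖{o}}(P(C(c))) ≤ P_{G∖{o}}(P(C(v))) + Δ(B)`.  Then
`P(P(C(c)), o ↔ A) ≤ P(P(C(o)), o ↔ A) + Σ_{B ⊆ A} Δ(B) · P(σ_B)`.
(`KozmaNitzan2024_thm8_event` is the case `c = a₀` the minimiser over `A`, `Δ ≡ 0`.)  Proof: `lemma5_add`
for each star `σ_B`, `∅ ≠ B ⊆ A` (`σ_B ⊆ {o ↔ A}`), summed with `real_eq_sum_inter_starEvent`; the `B = ∅`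
term vanishes. [cite: KozmaNitzan2024, Thm. 8 (p. 32), Thm. 4 (pp. 13–14)] -/
theorem thm8_add (w : Sym2 V → unitInterval) (A : Finset V) (o c : V) (P : Set V → Prop)
    (hP : ∀ S T : Set V, S ⊆ T → P S → P T) (hoA : o ∉ A) (hco : c ≠ o)
    (hiso : ∀ u, u ≠ o → u ∉ A → w s(o, u) = 0) (Δ : Finset V → ℝ) (hΔ0 : ∀ B, 0 ≤ Δ B)
    (hΔ : ∀ B ⊆ A, B.Nonempty → ∃ v ∈ B,
      (prodBernoulli w).real {ω | P {y | ω ∈ openConnIn ({o}ᶜ : Set V) c y}} ≤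
        (prodBernoulli w).real {ω | P {y | ω ∈ openConnIn ({o}ᶜ : Set V) v y}} + Δ B) :
    (prodBernoulli w).real ({ω | P (openCluster ω c)} ∩ ⋃ a' ∈ A, openConn o a') ≤
      (prodBernoulli w).real ({ω | P (openCluster ω o)} ∩ ⋃ a' ∈ A, openConn o a') +
        ∑ B ∈ A.powerset, Δ B * (prodBernoulli w).real (starEvent o ↑B) := by
  classical
  set μ := prodBernoulli w with hμ
  rw [real_eq_sum_inter_starEvent w A o hoA hiso ({ω | P (openCluster ω c)} ∩ _),
    real_eq_sum_inter_starEvent w A o hoA hiso ({ω | P (openCluster ω o)} ∩ _),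
    ← Finset.sum_add_distrib]
  refine Finset.sum_le_sum fun B hB => ?_
  have hBA : B ⊆ A := Finset.mem_powerset.1 hB
  have hσ0 : 0 ≤ Δ B * μ.real (starEvent o ↑B) := mul_nonneg (hΔ0 B) measureReal_nonneg
  rcases B.eq_empty_or_nonempty with rfl | hBne
  · -- under `σ_∅`, `0 ↮ A`: the `B = ∅` term vanishes
    have h0 : ({ω | P (openCluster ω c)} ∩ ⋃ a' ∈ A, openConn o a') ∩ starEvent o ↑(∅ : Finset V) =
        (∅ : Set (BondConfig V)) := by
      ext ω
      simp only [mem_inter_iff, mem_iUnion, exists_prop, mem_empty_iff_false, iff_false, not_and]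
      rintro ⟨-, a', ha', hoa'⟩ hσ
      rw [Finset.coe_empty] at hσ
      exact not_reachable_of_mem_starEvent_empty hσ (fun h => hoA (h ▸ ha')) hoa'
    rw [h0, measureReal_empty]
    linarith [measureReal_nonneg (μ := μ)
      (s := ({ω | P (openCluster ω o)} ∩ ⋃ a' ∈ A, openConn o a') ∩ starEvent o ↑(∅ : Finset V))]
  · -- `B ≠ ∅`: the lossy Lemma 5 with the given `v ∈ B`, and `σ_B ⊆ {0 ↔ v} ⊆ {0 ↔ A}`
    obtain ⟨v, hv, hcv⟩ := hΔ B hBA hBne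
    have hvo : v ≠ o := fun h => hoA (h ▸ hBA hv)
    have L5 := lemma5_add w o c v (↑B) P hP hco hvo (Finset.mem_coe.2 hv) (hΔ0 B) hcv
    have hσU : starEvent o (↑B : Set V) ⊆ ⋃ a' ∈ A, (openConn o a' : Set (BondConfig V)) := by
      intro ω hσ
      have hov : s(o, v) ∈ ω := ((mem_starEvent_iff o (↑B) ω).1 hσ v hvo).2 (Finset.mem_coe.2 hv)
      have hadj : (openGraph ω).Adj o v := (openGraph_adj ω o v).2 ⟨hov, hvo.symm⟩
      exact mem_iUnion₂.2 ⟨v, hBA hv, hadj.reachable⟩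
    calc μ.real (({ω | P (openCluster ω c)} ∩ ⋃ a' ∈ A, openConn o a') ∩ starEvent o ↑B)
        ≤ μ.real ({ω | P (openCluster ω c)} ∩ starEvent o ↑B) :=
          measureReal_mono fun ω ⟨⟨h1, _⟩, h2⟩ => ⟨h1, h2⟩
      _ ≤ μ.real ({ω | P (openCluster ω o)} ∩ starEvent o ↑B) + Δ B * μ.real (starEvent o ↑B) := L5
      _ ≤ μ.real (({ω | P (openCluster ω o)} ∩ ⋃ a' ∈ A, openConn o a') ∩ starEvent o ↑B) +
            Δ B * μ.real (starEvent o ↑B) := by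
          have := measureReal_mono (μ := μ)
            (show {ω | P (openCluster ω o)} ∩ starEvent o ↑B ⊆
              ({ω | P (openCluster ω o)} ∩ ⋃ a' ∈ A, openConn o a') ∩ starEvent o ↑B from
              fun ω ⟨h1, h2⟩ => ⟨⟨h1, hσU h2⟩, h2⟩)
          linarith

end Glue

/-! ### The crux's vocabulary: relay counts -/

variable {n : ℕ}

/-- **The lossy star transfer for the lower tail (one-layer observer, ANY fixed witness).**  Let every
positive-weight neighbour of the observer `o ∉ A` be a relay, `j` a level, `c ≠ o` ANY vertex, and
`Φ'(x) := μ{|π_{G∖{o}}(x)| ≤ j}` the probability that at most `j` relays are joined to `x` by open paths avoiding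
`o`.  If `Δ ≥ 0` and for every nonempty `B ⊆ A` some `v ∈ B` has `Φ'(v) ≤ Φ'(c) + Δ(B)` — i.e. `c` is, up to
`Δ(B)`, at least as fragile off `o` as some member of `B` (for `c ∈ B` take `v = c`) — then
`μ{1 ≤ N ≤ j} ≤ μ({o ↔ A} ∩ {|π(c)| ≤ j}) + Σ_{B ⊆ A} Δ(B) · μ(σ_B)`.
With `c` the champion of `G ∖ {o}` and `Δ ≡ 0` this is `Theorems.cumulativeIsolation_preFKG_of_isolatedObserver`;
the point of the slack is that `c` may now be fixed in advance (e.g. independently of the observer), the defect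
of fragility being paid additively and only on the star patterns where it occurs. [this work] -/
theorem lowerTail_le_add (w : Sym2 (Fin n) → unitInterval) (A : Finset (Fin n)) (o c : Fin n) (j : ℕ)
    (hoA : o ∉ A) (hco : c ≠ o) (hiso : ∀ u, u ≠ o → u ∉ A → w s(o, u) = 0)
    (Δ : Finset (Fin n) → ℝ) (hΔ0 : ∀ B, 0 ≤ Δ B)
    (hΔ : ∀ B ⊆ A, B.Nonempty → ∃ v ∈ B,
      (prodBernoulli w).real {ω : BondConfig (Fin n) |
          (A.filter fun x => ω ∈ openConnIn ({o}ᶜ : Set (Fin n)) v x).card ≤ j} ≤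
        (prodBernoulli w).real {ω : BondConfig (Fin n) |
          (A.filter fun x => ω ∈ openConnIn ({o}ᶜ : Set (Fin n)) c x).card ≤ j} + Δ B) :
    (prodBernoulli w).real {ω : BondConfig (Fin n) |
        1 ≤ (A.filter fun x => ω ∈ openConn o x).card ∧
          (A.filter fun x => ω ∈ openConn o x).card ≤ j} ≤
      (prodBernoulli w).real ((⋃ a' ∈ A, (openConn o a' : Set (BondConfig (Fin n)))) ∩
          {ω : BondConfig (Fin n) | (A.filter fun x => ω ∈ openConn c x).card ≤ j}) +
        ∑ B ∈ A.powerset, Δ B * (prodBernoulli w).real (starEvent o ↑B) := by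
  set μ := prodBernoulli w with hμ
  -- the monotone cluster property `|C ∩ A| ≥ j+1`
  set P : Set (Fin n) → Prop := fun S => j + 1 ≤ (A.filter fun x => x ∈ S).card with hP
  have hPmono : ∀ S T : Set (Fin n), S ⊆ T → P S → P T :=
    fun S T hST hS => le_trans hS (card_filter_mem_mono A hST)
  -- the off-`o` hypothesis in the `P`-form: `μ{P(C'(c))} ≤ μ{P(C'(v))} + Δ B` by complements
  have hΔ' : ∀ B ⊆ A, B.Nonempty → ∃ v ∈ B,
      μ.real {ω | P {y | ω ∈ openConnIn ({o}ᶜ : Set (Fin n)) c y}} ≤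
        μ.real {ω | P {y | ω ∈ openConnIn ({o}ᶜ : Set (Fin n)) v y}} + Δ B := by
    intro B hBA hBne
    obtain ⟨v, hv, hcv⟩ := hΔ B hBA hBne
    refine ⟨v, hv, ?_⟩
    have hcompl : ∀ x : Fin n, {ω : BondConfig (Fin n) | P {y | ω ∈ openConnIn ({o}ᶜ : Set (Fin n)) x y}} =
        {ω : BondConfig (Fin n) | (A.filter fun y => ω ∈ openConnIn ({o}ᶜ : Set (Fin n)) x y).card ≤ j}ᶜ := by
      intro x
      ext ω
      simp only [hP, mem_setOf_eq, mem_compl_iff, not_le]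
      omega
    rw [hcompl c, hcompl v, probReal_compl_eq_one_sub MeasurableSet.of_discrete,
      probReal_compl_eq_one_sub MeasurableSet.of_discrete]
    linarith
  have h8 := thm8_add w A o c P hPmono hoA hco hiso Δ hΔ0 hΔ'
  set R : Set (BondConfig (Fin n)) := ⋃ a' ∈ A, (openConn o a' : Set (BondConfig (Fin n))) with hR
  set Uo : Set (BondConfig (Fin n)) := {ω | P (openCluster ω o)} with hUo
  set Uc : Set (BondConfig (Fin n)) := {ω | P (openCluster ω c)} with hUc
  set E : ℝ := ∑ B ∈ A.powerset, Δ B * μ.real (starEvent o ↑B) with hE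
  have hmemR : ∀ ω, ω ∈ R ↔ 1 ≤ (A.filter fun x => ω ∈ openConn o x).card := by
    intro ω
    rw [Nat.succ_le_iff, Finset.card_pos, Finset.filter_nonempty_iff]
    simp only [hR, mem_iUnion, exists_prop]
  -- `{1 ≤ N ≤ j} = R ∖ Uo`
  have hL : {ω : BondConfig (Fin n) | 1 ≤ (A.filter fun x => ω ∈ openConn o x).card ∧
      (A.filter fun x => ω ∈ openConn o x).card ≤ j} = R \ Uo := by
    ext ω
    simp only [mem_setOf_eq, mem_sdiff, hmemR, hUo, hP, card_filter_mem_openCluster, not_le]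
    omega
  -- `R ∖ Uc ⊆ R ∩ {|π(c)| ≤ j}`
  have hT : R \ Uc ⊆ R ∩ {ω : BondConfig (Fin n) | (A.filter fun x => ω ∈ openConn c x).card ≤ j} := by
    rintro ω ⟨hωR, hωU⟩
    refine ⟨hωR, ?_⟩
    simp only [hUc, hP, mem_setOf_eq, card_filter_mem_openCluster, not_le] at hωU
    simp only [mem_setOf_eq]
    omega
  have e1 : μ.real (R ∩ Uo) + μ.real (R \ Uo) = μ.real R :=
    measureReal_inter_add_sdiff (MeasurableSet.of_discrete : MeasurableSet Uo) (measure_ne_top _ _)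
  have e2 : μ.real (R ∩ Uc) + μ.real (R \ Uc) = μ.real R :=
    measureReal_inter_add_sdiff (MeasurableSet.of_discrete : MeasurableSet Uc) (measure_ne_top _ _)
  have h8' : μ.real (R ∩ Uc) ≤ μ.real (R ∩ Uo) + E := by
    rw [inter_comm R Uc, inter_comm R Uo]
    exact h8
  rw [hL]
  calc μ.real (R \ Uo) = μ.real R - μ.real (R ∩ Uo) := by linarith
    _ ≤ μ.real R - μ.real (R ∩ Uc) + E := by linarith
    _ = μ.real (R \ Uc) + E := by linarith
    _ ≤ μ.real (R ∩ {ω : BondConfig (Fin n) | (A.filter fun x => ω ∈ openConn c x).card ≤ j}) + E := by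
        have := measureReal_mono (μ := μ) hT
        linarith

end LossyStar

end Summit.CriticalPhenomena.PercolationContinuityZ3.Theorems

end
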